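import Summits.BirchSwinnertonDyer.BirchSwinnertonDyer.Theorems.BiquadraticEisensteinDescentManinDatumSupercuspidalCMInertTorsionCoreOfResolventBound
import Summits.BirchSwinnertonDyer.BirchSwinnertonDyer.Theorems.BiquadraticEisensteinDescentManinDatumSupercuspidalCMInertTorsionSumRationalSeven
import Summits.BirchSwinnertonDyer.BirchSwinnertonDyer.Theorems.BiquadraticEisensteinDescentManinDatumSupercuspidalCMInertStubS7OfTorsionIntegral
import HarnessLib

set_option linter.dupNamespace false -- `Summit.BirchSwinnertonDyer.BirchSwinnertonDyer.Theorems.…` (summit = sub, D-0017)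
set_option autoImplicit false

/-!
# Crux `ManinDatumSupercuspidalCMInert` (stmt-BirchSwinnertonDyer-20111, BED r605): Core₇ and the registered stub `stub_S7` from the
# pure RESOLVENT BOUND RES₇ — `v(Σ_{b mod 7} conj((b/7)₄)^k·X(b̄/7)⁻ⁿ)⁴ ≤ v(7)^{4−k}` at every valuation of `ℂ` above `7`
# (width seat `bsd-wall-cm-bed-w2` g10; theorems only; route-independent imports; `--supports 20111`, helper)

Route `BiquadraticEisensteinDescent` (cell `pub/bsd-wall`). The last E-side composition of the 2026-08-28 width wave on the `j = 1728` cell: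
  `stub_S7` ⟸ T₇ (this seat p637774) ⟸ Core₇ (bed-w3 g9 p637721 `torsionIntegral_of_core`) ⟸ **RES₇** (THIS FILE), via
  bed-w3 g9's algebraization `torsionSum_eq_half_deriv_mul_sum` + `charSum_seven_eq_zero` (p638780/p639031: `T_k(w) = ½℘′(w)·Σ_b Φ(b)/(℘(w) − ℘(b̄/7))`
  for `w ∉ Λ`), this seat's expansion/packaging `coreSum_integral_of_resolventBound` (p639585) and, at lattice points `w ∈ Λ`, the vanishing of the
  torsion sum (pairing `b ↔ −b`, `E₁*(l + v) + E₁*(l − v) = 0`).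

* `torsionSum_seven_eq_zero_of_mem` — `T_k(l) = 0` for `l ∈ Λ`; `half_mul_mul_div_eq_varpi_mul` — a rescaling identity.
* `torsionSum_seven_eq_varpi_mul` — for `w ∉ Λ`: `T_k(w) = ϖ₀ · Y(w) · Σ_b Φ(b)/(X(w) − X(b̄/7))` (`X = ℘/ϖ₀²`, `Y = ℘′/(2ϖ₀³)`).
* ★ `core_seven_of_resolventBound` — **RES₇ ⟹ Core₇** (Core₇ = the hypothesis `hcore` of `torsionIntegral_of_core` at `q = 7`, verbatim), where
  **RES₇ := ∀ k ∈ {1,2,3}, ∀ n ≥ 1, ∀ valuation `v` of `ℂ` with `v 7 < 1`: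
  `v(Σ_{b : (ℤ/7)²} conj(((rep 7 b 0)/7)₄ : ℂ)^k · (℘(conj(rep 7 b 0)/7)/ϖ₀²)⁻ⁿ)⁴ ≤ v(7)^{4−k}`** — the statement bed-w4 g10's `resolvent_valuation_le`
  (p635728, `e = 48`, `ϖ = x/y(Q₁)`, `v ϖ⁴⁸ = v 7` by p636843) delivers with `j = 48 − 12k` once step (d) (the `(ℤ[i]/7)ˣ`-Galois structure of
  `ℚ(i)(E₀[7])`, design note MODEL-ASSEMBLY-LANES-w2g10.md) is in the tree.
* ★ `stub_S7_of_resolventBound` — **RES₇ ⟹ the REGISTERED SIGNATURE of `stub_S7` VERBATIM**.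

HONEST FRAMING: RES₇ is NOT proved here; nothing in this file proves the stub, the crux, Manin's conjecture or BSD. No definition, no named
fact, no `sorry`; axioms standard.
-/

noncomputable section

open scoped Classical ComplexConjugate

open Complex PeriodPair WeierstrassCurve IsDedekindDomain NumberField
open Literature.NumberTheory.EllipticCurves Literature.NumberTheory.EllipticCurves.GaussianLattice
open Literature.NumberTheory.LFunctions Literature.NumberTheory.LFunctions.GaussianTheta
open Literature.NumberTheory.QuadraticFields.GaussianQuarticSymbol
open Literature.NumberTheory.EllipticCurves.ModularForms
open Literature.NumberTheory.EllipticCurves.Rank1Residual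
open Literature.NumberTheory.DiophantineGeometry

namespace Summit.BirchSwinnertonDyer.BirchSwinnertonDyer.Theorems.BiquadraticEisensteinDescentManinDatumSupercuspidalCMInertStubS7OfResolventBound

open Summit.BirchSwinnertonDyer.BirchSwinnertonDyer.Theorems.BiquadraticEisensteinDescentManinDatumSupercuspidalCMInertTorsionSumRational
  (torsionSum_eq_sum_add torsionSum_eq_half_deriv_mul_sum divPoint_not_mem charSum_seven_eq_zero phiq_neg phiq_zero rep_zero_zero)
open Summit.BirchSwinnertonDyer.BirchSwinnertonDyer.Theorems.BiquadraticEisensteinDescentManinDatumSupercuspidalCMInertTorsionCoreBezoutFree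
  (phiq_periodic torsionIntegral_of_core)
open Summit.BirchSwinnertonDyer.BirchSwinnertonDyer.Theorems.BiquadraticEisensteinDescentManinDatumSupercuspidalCMInertTorsionCoreOfResolventBound
  (coreSum_integral_of_resolventBound)
open Summit.BirchSwinnertonDyer.BirchSwinnertonDyer.Theorems.BiquadraticEisensteinDescentManinDatumSupercuspidalCMInertStubS7OfTorsionIntegral
  (stub_S7_of_torsionIntegral)

/-! ## §1 The torsion sum at lattice points and off the lattice -/

/-- **`T_k(l) = 0` for `l ∈ Λ`**: the weight `conj((·/7)₄)^k` is even and `7`-periodic, so `Σ_b Φ(b)E₁*(l − b̄/7) = Σ_b Φ(b)E₁*(l + b̄/7)`,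
and `E₁*(l + v) + E₁*(l − v) = 0`. [folklore] -/
theorem torsionSum_seven_eq_zero_of_mem (k : ℕ) {l : ℂ} (hl : l ∈ (ofUpperHalfPlane UpperHalfPlane.I).lattice) :
    ∑ b : ZMod 7 × ZMod 7, (conj (((quarticCharMod 7 (rep 7 b 0) : GaussianInt) : ℂ))) ^ k *
        kroneckerE₁ (l - conj ((rep 7 b 0 : GaussianInt) : ℂ) / 7) = 0 := by
  haveI : NeZero (7 : ℕ) := ⟨by norm_num⟩
  have hadd : ∑ b : ZMod 7 × ZMod 7, (conj (((quarticCharMod 7 (rep 7 b 0) : GaussianInt) : ℂ))) ^ k *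
        kroneckerE₁ (l - conj ((rep 7 b 0 : GaussianInt) : ℂ) / 7) =
      ∑ b : ZMod 7 × ZMod 7, (conj (((quarticCharMod 7 (rep 7 b 0) : GaussianInt) : ℂ))) ^ k *
        kroneckerE₁ (l + conj ((rep 7 b 0 : GaussianInt) : ℂ) / 7) := by
    exact_mod_cast torsionSum_eq_sum_add 7 (Φ := fun x ↦ (conj (((quarticCharMod (7 : ℕ) x : GaussianInt) : ℂ))) ^ k)
      (phiq_periodic (q := 7) k) (phiq_neg (q := 7) (by norm_num) (by norm_num) k) l
  have h2 : 2 * ∑ b : ZMod 7 × ZMod 7, (conj (((quarticCharMod 7 (rep 7 b 0) : GaussianInt) : ℂ))) ^ k *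
        kroneckerE₁ (l - conj ((rep 7 b 0 : GaussianInt) : ℂ) / 7) = 0 := by
    rw [two_mul]
    nth_rewrite 1 [hadd]
    rw [← Finset.sum_add_distrib]
    refine Finset.sum_eq_zero fun b _ ↦ ?_
    rw [← mul_add, show l + conj ((rep 7 b 0 : GaussianInt) : ℂ) / 7 = conj ((rep 7 b 0 : GaussianInt) : ℂ) / 7 + l by ring,
      show l - conj ((rep 7 b 0 : GaussianInt) : ℂ) / 7 = -(conj ((rep 7 b 0 : GaussianInt) : ℂ) / 7) + l by ring,
      kroneckerE₁_add_of_mem _ hl, kroneckerE₁_add_of_mem _ hl, kroneckerE₁_neg, add_neg_cancel, mul_zero]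
  exact (mul_eq_zero.mp h2).resolve_left two_ne_zero

/-- Rescaling identity behind `torsionSum_seven_eq_varpi_mul`: `½·P′·(f/D) = ϖ·(P′/(2ϖ³))·(f/(D/ϖ²))` for `ϖ ≠ 0` (also when `D = 0`,
both sides being `0`). -/
theorem half_mul_mul_div_eq_varpi_mul {ϖ : ℂ} (hϖ : ϖ ≠ 0) (P f D : ℂ) :
    (1 / 2 : ℂ) * P * (f / D) = ϖ * (P / (2 * ϖ ^ 3) * (f / (D / ϖ ^ 2))) := by
  rcases eq_or_ne D 0 with rfl | hD
  · simp
  · field_simp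

/-- **Off the lattice: `T_k(w) = ϖ₀ · Y(w) · Σ_b Φ(b)/(X(w) − X(b̄/7))`** for `w ∉ Λ` with `M′w ∈ Λ`, `(M′, 7) = 1`, `k ∈ {1,2,3}`
(bed-w3 g9's `torsionSum_eq_half_deriv_mul_sum` with the character sum `charSum_seven_eq_zero`, read in the normalised coordinates
`X = ℘/ϖ₀²`, `Y = ℘′/(2ϖ₀³)`). [folklore] -/
theorem torsionSum_seven_eq_varpi_mul {k : ℕ} (hk1 : 1 ≤ k) (hk3 : k ≤ 3) {M' : ℕ} (hM : M'.Coprime 7)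
    {w : ℂ} (hw : w ∉ (ofUpperHalfPlane UpperHalfPlane.I).lattice)
    (hMw : (M' : ℂ) * w ∈ (ofUpperHalfPlane UpperHalfPlane.I).lattice) :
    ∑ b : ZMod 7 × ZMod 7, (conj (((quarticCharMod 7 (rep 7 b 0) : GaussianInt) : ℂ))) ^ k *
        kroneckerE₁ (w - conj ((rep 7 b 0 : GaussianInt) : ℂ) / 7) =
      ((Real.Gamma (1 / 4) ^ 2 / (2 * Real.sqrt (2 * Real.pi)) : ℝ) : ℂ) *
        ((℘'[ofUpperHalfPlane UpperHalfPlane.I] w / (2 * ((Real.Gamma (1 / 4) ^ 2 / (2 * Real.sqrt (2 * Real.pi)) : ℝ) : ℂ) ^ 3)) *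
          ∑ b : ZMod 7 × ZMod 7, (conj (((quarticCharMod 7 (rep 7 b 0) : GaussianInt) : ℂ))) ^ k /
            (℘[ofUpperHalfPlane UpperHalfPlane.I] w / ((Real.Gamma (1 / 4) ^ 2 / (2 * Real.sqrt (2 * Real.pi)) : ℝ) : ℂ) ^ 2 -
              ℘[ofUpperHalfPlane UpperHalfPlane.I] (conj ((rep 7 b 0 : GaussianInt) : ℂ) / 7) /
                ((Real.Gamma (1 / 4) ^ 2 / (2 * Real.sqrt (2 * Real.pi)) : ℝ) : ℂ) ^ 2)) := by
  haveI : NeZero (7 : ℕ) := ⟨by norm_num⟩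
  have h : ∑ b : ZMod 7 × ZMod 7, (conj (((quarticCharMod 7 (rep 7 b 0) : GaussianInt) : ℂ))) ^ k *
        kroneckerE₁ (w - conj ((rep 7 b 0 : GaussianInt) : ℂ) / 7) =
      (1 / 2 : ℂ) * ℘'[ofUpperHalfPlane UpperHalfPlane.I] w *
        ∑ b : ZMod 7 × ZMod 7, (conj (((quarticCharMod 7 (rep 7 b 0) : GaussianInt) : ℂ))) ^ k /
          (℘[ofUpperHalfPlane UpperHalfPlane.I] w - ℘[ofUpperHalfPlane UpperHalfPlane.I] (conj ((rep 7 b 0 : GaussianInt) : ℂ) / 7)) := by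
    exact_mod_cast torsionSum_eq_half_deriv_mul_sum 7 (Φ := fun x ↦ (conj (((quarticCharMod (7 : ℕ) x : GaussianInt) : ℂ))) ^ k)
      (phiq_periodic (q := 7) k) (phiq_neg (q := 7) (by norm_num) (by norm_num) k)
      (phiq_zero (q := 7) (by norm_num) (by norm_num) (k := k) (by omega)) (charSum_seven_eq_zero hk1 hk3) hM hw hMw
  rw [h]
  set ϖ : ℂ := ((Real.Gamma (1 / 4) ^ 2 / (2 * Real.sqrt (2 * Real.pi)) : ℝ) : ℂ) with hϖ
  have hϖ0 : ϖ ≠ 0 := Complex.ofReal_ne_zero.mpr varpi_pos.ne'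
  simp only [Finset.mul_sum]
  refine Finset.sum_congr rfl fun b _ ↦ ?_
  rw [← sub_div]
  exact half_mul_mul_div_eq_varpi_mul hϖ0 _ _ _

/-! ## §2 Core₇ from the resolvent bound -/

/-- ★ **RES₇ ⟹ Core₇.** If for every `k ∈ {1,2,3}`, `n ≥ 1` and every valuation `v` of `ℂ` with `v 7 < 1` the RESOLVENT BOUND
`v(Σ_b conj(((rep 7 b 0)/7)₄)^k · (℘(conj(rep 7 b 0)/7)/ϖ₀²)⁻ⁿ)⁴ ≤ v(7)^{4−k}` holds, then for every such `k`, every `M′` prime to `7` and every `w`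
with `M′w ∈ Λ`: `∃ s, 7 ∤ s, s · T_k(w)/(ϖ₀·7^{(4−k)/4}) ∈ ℤ̄` — the hypothesis `hcore` of bed-w3 g9's `torsionIntegral_of_core` at `q = 7`,
verbatim. [cite: Serre1979, Ch. IV §2 Prop. 7] -/
theorem core_seven_of_resolventBound
    (hRES : ∀ k : ℕ, 1 ≤ k → k ≤ 3 → ∀ n : ℕ, 1 ≤ n →
      ∀ (Γ₀ : Type) [LinearOrderedCommGroupWithZero Γ₀] (v : Valuation ℂ Γ₀), v 7 < 1 →
        v (∑ b : ZMod 7 × ZMod 7, (conj (((quarticCharMod 7 (rep 7 b 0) : GaussianInt) : ℂ))) ^ k *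
          (℘[ofUpperHalfPlane UpperHalfPlane.I] (conj ((rep 7 b 0 : GaussianInt) : ℂ) / 7) /
            ((Real.Gamma (1 / 4) ^ 2 / (2 * Real.sqrt (2 * Real.pi)) : ℝ) : ℂ) ^ 2)⁻¹ ^ n) ^ 4 ≤ v 7 ^ (4 - k)) :
    ∀ k : ℕ, 1 ≤ k → k ≤ 3 → ∀ (M' : ℕ) [NeZero M'], Nat.Coprime 7 M' →
      ∀ w : ℂ, ((M' : ℂ) * w) ∈ (ofUpperHalfPlane UpperHalfPlane.I).lattice →
        ∃ s : ℕ, ¬ 7 ∣ s ∧ IsIntegral ℤ ((s : ℂ) *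
          (∑ b : ZMod 7 × ZMod 7, (conj (((quarticCharMod 7 (rep 7 b 0) : GaussianInt) : ℂ))) ^ k *
            kroneckerE₁ (w - conj ((rep 7 b 0 : GaussianInt) : ℂ) / 7)) /
          ((((Real.Gamma (1 / 4) ^ 2 / (2 * Real.sqrt (2 * Real.pi))) : ℝ) : ℂ) * (7 : ℂ) ^ (((4 - k : ℕ) : ℂ) / 4))) := by
  intro k hk1 hk3 M' _ hcop w hMw
  haveI : NeZero (7 : ℕ) := ⟨by norm_num⟩
  have hM : M'.Coprime 7 := Nat.Coprime.symm hcop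
  by_cases hw : w ∈ (ofUpperHalfPlane UpperHalfPlane.I).lattice
  · refine ⟨1, by norm_num, ?_⟩
    rw [torsionSum_seven_eq_zero_of_mem k hw, mul_zero, zero_div]
    exact isIntegral_zero
  · -- the weight and the labelling of the `7`-division points
    set Φ : ZMod 7 × ZMod 7 → ℂ := fun b ↦ (conj (((quarticCharMod 7 (rep 7 b 0) : GaussianInt) : ℂ))) ^ k with hΦ
    set t : ZMod 7 × ZMod 7 → ℂ := fun b ↦ conj ((rep 7 b 0 : GaussianInt) : ℂ) / 7 with ht
    have hΦ0 : Φ 0 = 0 := by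
      rw [hΦ]; dsimp only
      rw [rep_zero_zero]
      exact_mod_cast phiq_zero (q := 7) (by norm_num) (by norm_num) (k := k) (by omega)
    have hΦint : ∀ b, IsIntegral ℤ (Φ b) := by
      intro b
      rw [hΦ]; dsimp only
      refine IsIntegral.pow ?_ k
      rcases quarticCharMod_eq_zero_or_pow_four (7 : ℤ) (rep 7 b 0) with h0 | h4
      · rw [h0, map_zero, map_zero]; exact isIntegral_zero
      · refine IsIntegral.of_pow (n := 4) (by norm_num) ?_
        rw [← map_pow, ← map_pow, h4, map_one, map_one]; exact isIntegral_one
    have htb : ∀ b, b ≠ 0 → t b ∉ (ofUpperHalfPlane UpperHalfPlane.I).lattice ∧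
        (7 : ℂ) * t b ∈ (ofUpperHalfPlane UpperHalfPlane.I).lattice := by
      intro b hb
      refine ⟨divPoint_not_mem 7 hb, ?_⟩
      rw [ht]; dsimp only
      rw [mul_div_cancel₀ _ (by norm_num : (7 : ℂ) ≠ 0)]
      exact conj_toComplex_mem_lattice _
    obtain ⟨s, hs, hint⟩ := coreSum_integral_of_resolventBound hk1 hk3 Φ hΦ0 hΦint t htb hw hMw hM
      (fun n hn Γ₀ _ v hv ↦ hRES k hk1 hk3 n hn Γ₀ v hv)
    refine ⟨s, hs, ?_⟩
    rw [torsionSum_seven_eq_varpi_mul hk1 hk3 hM hw hMw]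
    have hϖ0 : (((Real.Gamma (1 / 4) ^ 2 / (2 * Real.sqrt (2 * Real.pi))) : ℝ) : ℂ) ≠ 0 :=
      Complex.ofReal_ne_zero.mpr varpi_pos.ne'
    rw [mul_div_assoc, mul_div_mul_left _ _ hϖ0]
    exact hint

/-- ★ **RES₇ ⟹ the registered stub `stub_S7` (signature VERBATIM).** Composition `stub_S7_of_torsionIntegral ∘ torsionIntegral_of_core ∘
core_seven_of_resolventBound`: the j = 1728 supercuspidal CM Manin cell at `7` holds as soon as the resolvents of the `7`-division values of
the lemniscatic `℘` satisfy the tame count `v(R)⁴ ≤ v(7)^{4−k}`. [cite: Manin1972, Thm. 1.6] [cite: Serre1979, Ch. IV §2 Prop. 7] -/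
theorem stub_S7_of_resolventBound
    (hRES : ∀ k : ℕ, 1 ≤ k → k ≤ 3 → ∀ n : ℕ, 1 ≤ n →
      ∀ (Γ₀ : Type) [LinearOrderedCommGroupWithZero Γ₀] (v : Valuation ℂ Γ₀), v 7 < 1 →
        v (∑ b : ZMod 7 × ZMod 7, (conj (((quarticCharMod 7 (rep 7 b 0) : GaussianInt) : ℂ))) ^ k *
          (℘[ofUpperHalfPlane UpperHalfPlane.I] (conj ((rep 7 b 0 : GaussianInt) : ℂ) / 7) /
            ((Real.Gamma (1 / 4) ^ 2 / (2 * Real.sqrt (2 * Real.pi)) : ℝ) : ℂ) ^ 2)⁻¹ ^ n) ^ 4 ≤ v 7 ^ (4 - k)) :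
    ∀ (W : WeierstrassCurve ℚ) [W.IsElliptic] [W.IsGloballyMinimal] [NeZero (W.conductorNorm ℤ)] (p : ℕ)
      [Fact p.Prime] (D : ModularParametrizationData W (W.conductorNorm ℤ)) (v : IsDedekindDomain.HeightOneSpectrum ℤ),
      Rat.HeightOneSpectrum.natGenerator v = p → W.HasCM → W.analyticRank = 1 → p = 7 → W.j = 1728 →
      CMInert W p → ¬ Good W p → (∀ z ∈ D.L.lattice, ∃ w ∈ periodLattice D.f, z = D.c * w) →
      (W.kodairaSymbolAt v = .III ∨ W.kodairaSymbolAt v = .IIIstar) → ¬ (p : ℤ) ∣ D.c :=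
  haveI : NeZero (7 : ℕ) := ⟨by norm_num⟩
  stub_S7_of_torsionIntegral
    (torsionIntegral_of_core (q := 7) (by norm_num) (by norm_num) (core_seven_of_resolventBound hRES))

end Summit.BirchSwinnertonDyer.BirchSwinnertonDyer.Theorems.BiquadraticEisensteinDescentManinDatumSupercuspidalCMInertStubS7OfResolventBound

end
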